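import Summits.BirchSwinnertonDyer.BirchSwinnertonDyer.Theorems.KatoDescentTamePotSupersingularTameConjAResidueCartanRows01
import Summits.BirchSwinnertonDyer.BirchSwinnertonDyer.Theorems.KatoDescentTamePotSupersingularCartanMuRoadRealDoorsNoGrowth
import HarnessLib

/-!
# Route `KatoDescentTamePotSupersingular` (rung K8, sub-rung B4 (t′), cell `bsd-potss`): the `p = 3` RESIDUE ROWS of the Conj-A crux
# `TameCoatesSujathaResidue` (19916) — 130095bp1 and 470304m1 — RE-RECORDED with Coates–Sujatha Thm. 3.4 DISCHARGED and Iwasawa's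
# growth theorem REMOVED: (A) at `(E,3)` and U₀ `MissingUpperBoundAt E 3` modulo Ferrero–Washington alone (+ `hKatoA hGZK hmod` for U₀)
# and ONE classical `μ = 0` input on `ℚ(P)` (seat `bsd-potss-k8t-c4` g22; `--supports stmt-BirchSwinnertonDyer-19982 --as helper`; closes nothing)

HONEST FRAMING. Route-free THEOREMS ONLY. g16's records (`…TameConjAResidueCartanRows01`, p632365) display `hCS hI hFW` (+ U₀ inputs); with
`CoatesSujatha2005.thm34_…_holds` (p694085) and the hI-free doors `CartanMuRoadRealDoorsNoGrowth` (g22) the same rows are recorded here with ONLY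
`hFW` (and `hKatoA hGZK hmod`) displayed: named-fact debt −2 per row. Kernel certificates (`irr_…`, `addv_…`, `subTprime_…`) are REUSED from the
g16 file, not restated. Per row; nothing booked; (A) / BSD proved for no curve.
[cite: CoatesSujatha2005, Thm. 3.4 (§3)] [cite: Kato2004Asterisque, Thm. 14.5 (3) (p. 236)] [cite: Washington1997, §13.1, §13.3 Prop. 13.23]
[cite: Cremona2006, Table 1]
-/

set_option autoImplicit false
set_option linter.dupNamespace false

noncomputable section

open scoped Classical NumberField
open WeierstrassCurve NumberField Field IntermediateField
  Literature.NumberTheory.EllipticCurves Literature.NumberTheory.EllipticCurves.Rank1Residual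
  Literature.NumberTheory.EllipticCurves.Rank1Residual.Typed
  Literature.NumberTheory.GaloisRepresentations Literature.NumberTheory.SerreUniformity Literature.NumberTheory.IwasawaTheory
  Summit.BirchSwinnertonDyer.Rank1Residual Summit.BirchSwinnertonDyer.Rank1Residual.Additive
  Summit.BirchSwinnertonDyer.BirchSwinnertonDyer.Theorems

namespace Summit.BirchSwinnertonDyer.BirchSwinnertonDyer.Theorems.TameUpperUnitTwistRecords

/-! ### `130095bp1` @ `p = 3` -/

/-- **(A) at `(130095bp1, 3)` from ONE classical `μ`-hypothesis on `ℚ(P)`, modulo Ferrero–Washington ALONE** (no `hCS`, no `hI`): door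
`CartanMuRoadRealDoorsNoGrowth.conjA_three_of_hasModPImageEqNonsplitCartanNormalizer_of_realMu`. CONDITIONAL; (A) asserted for no curve.
[cite: CoatesSujatha2005, Thm. 3.4 (§3)] [cite: Serre1972, §2.2, §5.2 (iv)] [cite: Washington1997, §13.3 Prop. 13.23] [cite: Cremona2006, Table 1 (Cremona label 130095bp1)] -/
theorem conjA_g130095bp1_3_noGrowth
    (hFW : ferreroWashington1979_classicalMuVanishes)
    {W : WeierstrassCurve ℚ} [W.IsElliptic] (hWeq : W = (⟨0, 0, 1, (-610197), (-1022424433)⟩ : WeierstrassCurve ℚ))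
    (himg : HasModPImageEqNonsplitCartanNormalizer W 3)
    {c : absoluteGaloisGroup ℚ} (hc : IsComplexConjugation (Rat.castHom ℝ) c)
    (hμ : ∀ κE : ZpExtension ↥(fixedField (Subgroup.zpowers (absRestrictNormalHom (W.divisionField 3) c))) 3,
      κE.IsCyclotomic → ClassicalMuVanishes κE)
    (κ : ZpExtension ℚ 3) (hκ : κ.IsCyclotomic) :
    ∃ (γ : absoluteGaloisGroup ℚ) (Df : W.FineSelmerDualData κ γ),
      Module.Finite ℤ_[3] (RestrictScalars ℤ_[3] (IwasawaAlgebra 3) Df.X) := by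
  subst hWeq
  exact CartanMuRoadRealDoorsNoGrowth.conjA_three_of_hasModPImageEqNonsplitCartanNormalizer_of_realMu _ hFW himg hc hμ κ hκ

/-- **RECORD — UPPER half `ord₃ #Ш(E) ≤ ord₃ #Ш(E)_an` for `E = 130095bp1` at `p = 3`, modulo `hKatoA hGZK hmod hFW` ONLY** (Coates–Sujatha 3.4
discharged, growth theorem removed; door `CartanMuRoadRealDoorsNoGrowth.missingUpperBoundAt_three_tame_of_hasModPImageEqNonsplitCartanNormalizer_of_realMu`;
kernel certificates `irr_g130095bp1_3`, `addv_g130095bp1_3`, `subTprime_g130095bp1_3` reused). Per row; nothing booked; BSD is not proved by this.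
[cite: Kato2004Asterisque, Thm. 14.5 (3) (p. 236), Thm. 12.5 (3) (p. 222)] [cite: CoatesSujatha2005, Thm. 3.4 (§3)] [cite: Washington1997, §13.3 Prop. 13.23]
[cite: Cremona2006, Table 1 (Cremona label 130095bp1)] -/
theorem missingUpperBoundAt_g130095bp1_3_noGrowth
    (hKatoA : Kato2004.rankZero_padicValNat_sha_add_padicValNat_tamagawa_le_of_additive_potGood_of_irreducible_of_fineSelmerDual_fg)
    (hGZK : rank_eq_analyticRank_of_analyticRank_le_one) (hmod : hasEntireLFunction_rat)
    (hFW : ferreroWashington1979_classicalMuVanishes)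
    {W : WeierstrassCurve ℚ} [W.IsElliptic] [W.IsGloballyMinimal] (hWeq : W = (⟨0, 0, 1, (-610197), (-1022424433)⟩ : WeierstrassCurve ℚ)) (hr : W.analyticRank = 0)
    (himg : HasModPImageEqNonsplitCartanNormalizer W 3)
    {c : absoluteGaloisGroup ℚ} (hc : IsComplexConjugation (Rat.castHom ℝ) c)
    (hμ : ∀ κE : ZpExtension ↥(fixedField (Subgroup.zpowers (absRestrictNormalHom (W.divisionField 3) c))) 3,
      κE.IsCyclotomic → ClassicalMuVanishes κE) :
    MissingUpperBoundAt W 3 := by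
  subst hWeq
  haveI : Fact (Nat.Prime 3) := ⟨Nat.prime_three⟩
  exact CartanMuRoadRealDoorsNoGrowth.missingUpperBoundAt_three_tame_of_hasModPImageEqNonsplitCartanNormalizer_of_realMu _ hKatoA hGZK
    hmod hFW hr addv_g130095bp1_3 subTprime_g130095bp1_3 irr_g130095bp1_3 himg hc hμ

/-! ### `470304m1` @ `p = 3` -/

/-- **(A) at `(470304m1, 3)` from ONE classical `μ`-hypothesis on `ℚ(P)`, modulo Ferrero–Washington ALONE** (no `hCS`, no `hI`). CONDITIONAL;
(A) asserted for no curve. [cite: CoatesSujatha2005, Thm. 3.4 (§3)] [cite: Serre1972, §2.2, §5.2 (iv)] [cite: Washington1997, §13.3 Prop. 13.23]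
[cite: Cremona2006, Table 1 (Cremona label 470304m1)] -/
theorem conjA_g470304m1_3_noGrowth
    (hFW : ferreroWashington1979_classicalMuVanishes)
    {W : WeierstrassCurve ℚ} [W.IsElliptic] (hWeq : W = (⟨0, 0, 0, (-1109592), (-450778608)⟩ : WeierstrassCurve ℚ))
    (himg : HasModPImageEqNonsplitCartanNormalizer W 3)
    {c : absoluteGaloisGroup ℚ} (hc : IsComplexConjugation (Rat.castHom ℝ) c)
    (hμ : ∀ κE : ZpExtension ↥(fixedField (Subgroup.zpowers (absRestrictNormalHom (W.divisionField 3) c))) 3,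
      κE.IsCyclotomic → ClassicalMuVanishes κE)
    (κ : ZpExtension ℚ 3) (hκ : κ.IsCyclotomic) :
    ∃ (γ : absoluteGaloisGroup ℚ) (Df : W.FineSelmerDualData κ γ),
      Module.Finite ℤ_[3] (RestrictScalars ℤ_[3] (IwasawaAlgebra 3) Df.X) := by
  subst hWeq
  exact CartanMuRoadRealDoorsNoGrowth.conjA_three_of_hasModPImageEqNonsplitCartanNormalizer_of_realMu _ hFW himg hc hμ κ hκ

/-- **RECORD — UPPER half for `E = 470304m1` at `p = 3`, modulo `hKatoA hGZK hmod hFW` ONLY** (Coates–Sujatha 3.4 discharged, growth theorem removed;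
kernel certificates `irr_g470304m1_3`, `addv_g470304m1_3`, `subTprime_g470304m1_3` reused). Per row; nothing booked; BSD is not proved by this.
[cite: Kato2004Asterisque, Thm. 14.5 (3) (p. 236), Thm. 12.5 (3) (p. 222)] [cite: CoatesSujatha2005, Thm. 3.4 (§3)] [cite: Washington1997, §13.3 Prop. 13.23]
[cite: Cremona2006, Table 1 (Cremona label 470304m1)] -/
theorem missingUpperBoundAt_g470304m1_3_noGrowth
    (hKatoA : Kato2004.rankZero_padicValNat_sha_add_padicValNat_tamagawa_le_of_additive_potGood_of_irreducible_of_fineSelmerDual_fg)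
    (hGZK : rank_eq_analyticRank_of_analyticRank_le_one) (hmod : hasEntireLFunction_rat)
    (hFW : ferreroWashington1979_classicalMuVanishes)
    {W : WeierstrassCurve ℚ} [W.IsElliptic] [W.IsGloballyMinimal] (hWeq : W = (⟨0, 0, 0, (-1109592), (-450778608)⟩ : WeierstrassCurve ℚ)) (hr : W.analyticRank = 0)
    (himg : HasModPImageEqNonsplitCartanNormalizer W 3)
    {c : absoluteGaloisGroup ℚ} (hc : IsComplexConjugation (Rat.castHom ℝ) c)
    (hμ : ∀ κE : ZpExtension ↥(fixedField (Subgroup.zpowers (absRestrictNormalHom (W.divisionField 3) c))) 3,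
      κE.IsCyclotomic → ClassicalMuVanishes κE) :
    MissingUpperBoundAt W 3 := by
  subst hWeq
  haveI : Fact (Nat.Prime 3) := ⟨Nat.prime_three⟩
  exact CartanMuRoadRealDoorsNoGrowth.missingUpperBoundAt_three_tame_of_hasModPImageEqNonsplitCartanNormalizer_of_realMu _ hKatoA hGZK
    hmod hFW hr addv_g470304m1_3 subTprime_g470304m1_3 irr_g470304m1_3 himg hc hμ

end Summit.BirchSwinnertonDyer.BirchSwinnertonDyer.Theorems.TameUpperUnitTwistRecords

end
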